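/-
Origin: expansion seat `planner-pub-hodgecm-pv14-g3-0`, handover #5 2026-08-18T05:51:27Z (`HOME/pub-hodgecm-pv14-g3/lean/Pv14g3/PerL34/P43KTypesBall.lean`, md5 52375b51, 195 lines);
landed by the gen-6 packager in gate run 24 as `HodgeCM/PerL34/P43_KTypesBall.lean` (import ^import Pv14g3\.PerL34\.P43KTypesU2Gen\b→import HodgeCM.PerL34.P43_KTypesU2Gen ×1).
-/
/-
Origin: HOME/pub-hodgecm-pv14-g3/lean/Pv14g3/PerL34/P43KTypesBall.lean — session planner-pub-hodgecm-pv14-g3-0 (unit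
pub-hodgecm-pv14-g3, DAG-NODE PROVER #14 gen 3).  Intended final place: `HodgeCM/PerL34/P43_KTypesBall.lean`, after
`P43_KTypesU2Gen.lean` (this seat) and `BallCRKType.lean` (pv02-g3, run 23).  On landing rewrite the import
`Pv14g3.PerL34.P43KTypesU2Gen` ↦ `HodgeCM.PerL34.P43_KTypesU2Gen`.  DAG node **N33b** (PerL v5 Prop 4.3 proof, tex
l. 646: "`K_{ι₁} = U(2) × U(1)`", ll. 646–652 `𝔭_±`).  Nothing cited, nothing asserted.
-/
import Summits.HodgeConjecture.HodgeCM.PerL34.P43_KTypesU2Gen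
import Summits.HodgeConjecture.HodgeCM.PerL34.BallCRKType

set_option autoImplicit false

/-!
# N33b (X1), concrete `K_{ι₁}`-types V: `K = U(2) × U(1)` IS the stabiliser of `x₀` in `U(2,1)`; `𝔭_± = Ad`

CONVENTION LOCK between the abstract `K`-modules of `P43_KTypesU2` / `P43_KTypesU2Gen` (used in the Schur
computation (X1): `𝔭₋ ⊗ 𝔭₊ ≅ F_{0,0} ⊕ F_{1,1}`) and pv02/pv03's ball model `BallModel.U21 = U(2,1)` acting on `𝔹²`
(used in (X2) and in `BallCRKType`):

* `blockDiag : K →* BallModel.U21`, `(A,d) ↦ diag(A,d)`; it is injective, lands in the stabiliser of `x₀ = 0 ∈ 𝔹²`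
  (`blockDiag_stab`), and EVERY stabiliser element is a `blockDiag k` (`exists_blockDiag_of_stab`), i.e.
  **`stab_iff_mem_range : g • x₀ = x₀ ↔ g ∈ blockDiag.range`** — PerL l. 646 "`K_{ι₁} = U(2) × U(1)`" in the kernel;
* **`pPlus_eq_Jac`**: `pPlus k v = Jac (blockDiag k) x₀ · v` — the abstract `𝔭₊` (`(A,d)·v = d̄ A v`) is the isotropy
  representation of `K` on `T_{x₀}𝔹²`, which by pv02-g3 `BallCR.mat_mul_Xplus_of_stab` is `Ad(K)|_{𝔭₊}`;
* **`Ad_blockDiag_Xplus`**, **`Ad_blockDiag_Xlow`**: `diag(A,d) · X₊(v) · diag(A,d)⁻¹ = X₊(pPlus k v)` and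
  `diag(A,d) · X₋(w) · diag(A,d)⁻¹ = X₋(pMinus k w)` for pv02-g3's root spaces `BallCR.Xplus`, `BallCR.Xlow` — so the
  abstract `𝔭₊`, `𝔭₋` of the (X1) files are literally `Ad(K_{ι₁})` on `𝔭₊`, `𝔭₋ ⊂ 𝔤𝔩₃(ℂ)`.
-/

noncomputable section

namespace HodgeCM
namespace PerL34
namespace P43KTypesU2

open Matrix Complex

/-! ## The block-diagonal matrix of `k = (A,d)` -/

/-- `bd (A,d) = diag(A, d) ∈ M₃(ℂ)`. -/
def bd (k : K) : Matrix (Fin 3) (Fin 3) ℂ :=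
  !![mat k 0 0, mat k 0 1, 0; mat k 1 0, mat k 1 1, 0; 0, 0, (k.2 : ℂ)]

/-- (Ported verbatim from the HodgeCMPerL package; no docstring in the source.) -/
@[simp] theorem bd_cs_cs (k : K) (i j : Fin 2) : bd k (Fin.castSucc i) (Fin.castSucc j) = mat k i j := by
  fin_cases i <;> fin_cases j <;> rfl

/-- (Ported verbatim from the HodgeCMPerL package; no docstring in the source.) -/
@[simp] theorem bd_cs_two (k : K) (i : Fin 2) : bd k (Fin.castSucc i) 2 = 0 := by
  fin_cases i <;> rfl

/-- (Ported verbatim from the HodgeCMPerL package; no docstring in the source.) -/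
@[simp] theorem bd_two_cs (k : K) (j : Fin 2) : bd k 2 (Fin.castSucc j) = 0 := by
  fin_cases j <;> rfl

/-- (Ported verbatim from the HodgeCMPerL package; no docstring in the source.) -/
@[simp] theorem bd_two_two (k : K) : bd k 2 2 = (k.2 : ℂ) := rfl

/-- (Ported verbatim from the HodgeCMPerL package; no docstring in the source.) -/
theorem mat_inv (k : K) : mat k⁻¹ = star (mat k) := rfl

/-- (Ported verbatim from the HodgeCMPerL package; no docstring in the source.) -/
theorem coe_snd_inv (k : K) : ((k⁻¹).2 : ℂ) = star (k.2 : ℂ) := rfl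

/-- (Ported verbatim from the HodgeCMPerL package; no docstring in the source.) -/
theorem coe_inv_unitary (d : unitary ℂ) : ((d⁻¹ : unitary ℂ) : ℂ) = star (d : ℂ) := rfl

/-- (Ported verbatim from the HodgeCMPerL package; no docstring in the source.) -/
theorem bd_one : bd 1 = 1 := by
  ext i j
  fin_cases i <;> fin_cases j <;> simp [bd, mat]

/-- (Ported verbatim from the HodgeCMPerL package; no docstring in the source.) -/
theorem bd_mul (k k' : K) : bd (k * k') = bd k * bd k' := by
  ext i j
  fin_cases i <;> fin_cases j <;>
    simp [bd, mat, Matrix.mul_apply, Fin.sum_univ_three, Fin.sum_univ_two]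

/-- (Ported verbatim from the HodgeCMPerL package; no docstring in the source.) -/
theorem conjTranspose_bd (k : K) : (bd k)ᴴ = bd k⁻¹ := by
  ext i j
  fin_cases i <;> fin_cases j <;> simp [bd, mat_inv, coe_inv_unitary, Matrix.conjTranspose_apply, Matrix.star_apply]

/-- (Ported verbatim from the HodgeCMPerL package; no docstring in the source.) -/
theorem J_mul_bd (k : K) : BallModel.J * bd k = bd k * BallModel.J := by
  ext i j
  fin_cases i <;> fin_cases j <;> simp [bd, BallModel.J, Matrix.mul_apply, Fin.sum_univ_three]

/-- (Ported verbatim from the HodgeCMPerL package; no docstring in the source.) -/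
theorem bd_mem (k : K) : (bd k)ᴴ * BallModel.J * bd k = BallModel.J := by
  rw [conjTranspose_bd, Matrix.mul_assoc, J_mul_bd, ← Matrix.mul_assoc, ← bd_mul, inv_mul_cancel, bd_one,
    Matrix.one_mul]

/-- `diag(A,d)` as an element of `GL₃(ℂ)`. -/
def bdGL : K →* BallModel.GL3 where
  toFun k := ⟨bd k, bd k⁻¹, by rw [← bd_mul, mul_inv_cancel, bd_one], by rw [← bd_mul, inv_mul_cancel, bd_one]⟩
  map_one' := Units.ext bd_one
  map_mul' k k' := Units.ext (bd_mul k k')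

/-- (Ported verbatim from the HodgeCMPerL package; no docstring in the source.) -/
@[simp] theorem coe_bdGL (k : K) : ((bdGL k : BallModel.GL3) : Matrix (Fin 3) (Fin 3) ℂ) = bd k := rfl

/-- **`K = U(2) × U(1) → U(2,1)`**, `(A,d) ↦ diag(A,d)`. -/
def blockDiag : K →* BallModel.U21 :=
  bdGL.codRestrict BallModel.U21 (fun k => show (bd k)ᴴ * BallModel.J * bd k = BallModel.J from bd_mem k)

/-- (Ported verbatim from the HodgeCMPerL package; no docstring in the source.) -/
@[simp] theorem mat_blockDiag (k : K) : BallModel.mat (blockDiag k) = bd k := rfl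

/-- (Ported verbatim from the HodgeCMPerL package; no docstring in the source.) -/
theorem blockDiag_injective : Function.Injective blockDiag := by
  intro k k' h
  have hM : bd k = bd k' := by rw [← mat_blockDiag, ← mat_blockDiag, h]
  refine Prod.ext (Subtype.ext ?_) (Subtype.ext ?_)
  · ext i j
    have := congrFun (congrFun hM (Fin.castSucc i)) (Fin.castSucc j)
    simpa using this
  · simpa using congrFun (congrFun hM 2) 2

/-! ## `blockDiag K` is the stabiliser of `x₀` -/

/-- (Ported verbatim from the HodgeCMPerL package; no docstring in the source.) -/
theorem blockDiag_stab (k : K) : blockDiag k • BallModel.x₀ = BallModel.x₀ :=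
  (BallCR.stab_iff _).2 (fun i => by rw [mat_blockDiag, bd_cs_two])

/-- (Ported verbatim from the HodgeCMPerL package; no docstring in the source.) -/
theorem coe_snd_ne_zero (k : K) : (k.2 : ℂ) ≠ 0 :=
  left_ne_zero_of_mul_eq_one (Unitary.mul_star_self_of_mem k.2.prop)

/-- For a stabiliser element `g`: its off-diagonal blocks vanish, `|g₂₂| = 1` and its upper-left block is unitary
— so `g = diag(A,d)` for some `(A,d) ∈ K`. -/
theorem exists_blockDiag_of_stab {g : BallModel.U21} (hg : g • BallModel.x₀ = BallModel.x₀) :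
    ∃ k : K, blockDiag k = g := by
  have hu0 : BallModel.mat g 0 2 = 0 := BallCR.stab_upper hg 0
  have hu1 : BallModel.mat g 1 2 = 0 := BallCR.stab_upper hg 1
  have hl0 : BallModel.mat g 2 0 = 0 := BallCR.stab_lower hg 0
  have hl1 : BallModel.mat g 2 1 = 0 := BallCR.stab_lower hg 1
  have h22 : (starRingEnd ℂ) (BallModel.mat g 2 2) * BallModel.mat g 2 2 = 1 := BallCR.stab_norm22 hg
  -- the upper-left block
  let A : Matrix (Fin 2) (Fin 2) ℂ := Matrix.of fun i j => BallModel.mat g (Fin.castSucc i) (Fin.castSucc j)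
  have hmem := BallModel.mat_mem g
  have hA : star A * A = 1 := by
    ext i j
    have hij := congrFun (congrFun hmem (Fin.castSucc i)) (Fin.castSucc j)
    rw [Matrix.mul_apply, Fin.sum_univ_two]
    simp only [Matrix.star_apply, Matrix.of_apply, A]
    rw [Matrix.mul_apply, Fin.sum_univ_three] at hij
    simp only [Matrix.mul_apply, Fin.sum_univ_three, Matrix.conjTranspose_apply, BallModel.J,
      Matrix.diagonal_apply] at hij
    fin_cases i <;> fin_cases j <;> simp [hl0, hl1] at hij ⊢ <;> exact hij
  have hd : BallModel.mat g 2 2 ∈ unitary ℂ := by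
    rw [Unitary.mem_iff]
    constructor
    · exact h22
    · rw [mul_comm]; exact h22
  refine ⟨(⟨A, Matrix.mem_unitaryGroup_iff'.mpr hA⟩, ⟨BallModel.mat g 2 2, hd⟩), ?_⟩
  apply Subtype.ext
  apply Units.ext
  show bd _ = BallModel.mat g
  ext i j
  fin_cases i <;> fin_cases j <;> simp [bd, mat, A, hu0, hu1, hl0, hl1]

/-- **`K_{ι₁} = U(2) × U(1)`** (PerL l. 646): the stabiliser of `x₀ ∈ 𝔹²` in `U(2,1)` is exactly `blockDiag K`. -/
theorem stab_iff_mem_range (g : BallModel.U21) : g • BallModel.x₀ = BallModel.x₀ ↔ g ∈ blockDiag.range := by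
  constructor
  · intro hg
    obtain ⟨k, rfl⟩ := exists_blockDiag_of_stab hg
    exact ⟨k, rfl⟩
  · rintro ⟨k, rfl⟩
    exact blockDiag_stab k

/-! ## `𝔭₊` is the isotropy representation; `𝔭_± = Ad(K)` on the root spaces -/

/-- The Jacobian of `diag(A,d)` at `x₀` is `d⁻¹ A = d̄ A`. -/
theorem Jac_blockDiag (k : K) : BallModel.Jac (blockDiag k) BallModel.x₀ = star (k.2 : ℂ) • mat k := by
  ext i j
  rw [BallCR.Jac_of_stab (blockDiag_stab k), Matrix.smul_apply, smul_eq_mul, mat_blockDiag, bd_cs_cs, bd_two_two,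
    div_eq_iff (coe_snd_ne_zero k), mul_comm (star _) _, mul_assoc, Unitary.star_mul_self_of_mem k.2.prop, mul_one]

/-- **`𝔭₊` = the isotropy representation of `K` on `T_{x₀}𝔹² = ℂ²`.** -/
theorem pPlus_eq_Jac (k : K) (v : Fin 2 → ℂ) : pPlus k v = BallModel.Jac (blockDiag k) BallModel.x₀ *ᵥ v := by
  rw [Jac_blockDiag, Matrix.smul_mulVec, pPlus_apply]

/-- pv02-g3's `Ad(k)|_{𝔭₊} = Jac k x₀`, specialised: `diag(A,d) · X₊(v) = X₊(pPlus k v) · diag(A,d)`. -/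
theorem bd_mul_Xplus (k : K) (v : Fin 2 → ℂ) : bd k * BallCR.Xplus v = BallCR.Xplus (pPlus k v) * bd k := by
  have h := BallCR.mat_mul_Xplus_of_stab (blockDiag_stab k) v
  rwa [mat_blockDiag, ← pPlus_eq_Jac] at h

/-- **`𝔭₊ = Ad(K)|_{𝔭₊}`**: `diag(A,d) · X₊(v) · diag(A,d)⁻¹ = X₊(pPlus k v)`. -/
theorem Ad_blockDiag_Xplus (k : K) (v : Fin 2 → ℂ) : bd k * BallCR.Xplus v * bd k⁻¹ = BallCR.Xplus (pPlus k v) := by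
  rw [bd_mul_Xplus, Matrix.mul_assoc, ← bd_mul, mul_inv_cancel, bd_one, Matrix.mul_one]

/-- **`𝔭₋ = Ad(K)|_{𝔭₋}`**: `diag(A,d) · X₋(w) · diag(A,d)⁻¹ = X₋(pMinus k w)` (`pMinus (A,d) w = d Ā w`). -/
theorem Ad_blockDiag_Xlow (k : K) (w : Fin 2 → ℂ) : bd k * BallCR.Xlow w * bd k⁻¹ = BallCR.Xlow (pMinus k w) := by
  ext i j
  fin_cases i <;> fin_cases j <;>
    simp [bd, BallCR.Xlow, mat_inv, coe_inv_unitary, Matrix.mul_apply, Fin.sum_univ_three, pMinus_apply, cmat,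
      Matrix.star_apply]
  all_goals ring

/-- Summary (CONVENTION LOCK): `K_{ι₁} = Stab(x₀) = U(2) × U(1)`, `𝔭₊ = Ad|_{X₊} =` isotropy, `𝔭₋ = Ad|_{X₋}`. -/
theorem conventionLock (k : K) (v w : Fin 2 → ℂ) :
    blockDiag k • BallModel.x₀ = BallModel.x₀ ∧ pPlus k v = BallModel.Jac (blockDiag k) BallModel.x₀ *ᵥ v ∧
      bd k * BallCR.Xplus v * bd k⁻¹ = BallCR.Xplus (pPlus k v) ∧
      bd k * BallCR.Xlow w * bd k⁻¹ = BallCR.Xlow (pMinus k w) :=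
  ⟨blockDiag_stab k, pPlus_eq_Jac k v, Ad_blockDiag_Xplus k v, Ad_blockDiag_Xlow k w⟩

end P43KTypesU2
end PerL34
end HodgeCM

end
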